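import Mathlib.Topology.Algebra.OpenSubgroup
import Mathlib.GroupTheory.GroupAction.Quotient
import Mathlib.CategoryTheory.Adjunction.Basic
import Mathlib.CategoryTheory.Functor.FullyFaithful
import Mathlib.CategoryTheory.IsConnected
import Literature.AlgebraicGeometry.Frobenioids.Categories
import HarnessLib

/-!
# The small category of coset spaces `G/U` (`U` open) of a topological group; pull-back and push-forward
# along an open surjection ([FrdII] Ex. 1.3 (i)–(ii); the base `𝓑(X̲→_v)⁰ ⊇ 𝓑(K_v)⁰` of [IUTchI] Ex. 3.3 (i))

Mochizuki, *The geometry of Frobenioids II*, Kyushu J. Math. **62** (2008), §1 Example 1.3 (i)–(ii), author's text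
p. 11 [cite: MochizukiFrdII2008, Ex 1.3 (i)(ii) p.11]: (i) "the set of cosets `Π/Π°` equipped with its natural
`Π`-action from the left"; "if `Π` is profinite, then … `𝓑^temp(Π)⁰ ≃ 𝓑(Π)⁰`"; (ii) for a surjective open
homomorphism `φ : Π₁ → Π₂`: "`φ` induces a natural functor `φ_* : 𝓑^temp(Π₁)⁰ → 𝓑^temp(Π₂)⁰` that is left adjoint
to the natural pull-back functor `𝓑^temp(Π₂)⁰ → 𝓑^temp(Π₁)⁰`". Mochizuki, *Inter-universal Teichmüller Theory I*,
Ex. 3.3 (i) pp. 77–78 [cite: Mochizuki2012, I Ex 3.3 (i) pp.77-78]: "`D⊢_v` may be naturally regarded … as a full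
subcategory `D⊢_v ⊆ D_v` … a natural functor `D_v → D⊢_v`, which is left-adjoint to the natural inclusion functor".

WHY THIS FILE (a SMALL model). The connected objects of `𝓑^temp(Π)` / `𝓑(Π)` are the one-orbit `Π`-sets with open
stabilisers, i.e. the coset spaces `Π/U`, `U ⊆ Π` open (the tree's `ConnectedPart (BTemp Π)`, whose
`QuasiTemperoid.pushforwardAdjunction` is [FrdII] Ex. 1.3 (ii)); those categories have objects in `Type (u+1)` and
morphisms in `Type u`, whereas abc-iut-L5-t2's frozen interface `GoodLocalFrobenioid.{u}` ([IUTchI] Ex. 3.3) asks for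
SMALL bases (`Dv : Type u`, `Category.{u} Dv`). This file provides the small skeleton: `CosetCat G` — objects the open
subgroups `U` (standing for `G/U`), morphisms the `G`-equivariant maps `G/U → G/V` — and, for a continuous surjection
`aug : P → G`: `CosetCat.pull aug` (`V ↦ aug⁻¹ V`; FULL and FAITHFUL), `CosetCat.push aug` (`U ↦ aug(U)`, `aug` open;
the functor `φ_*`), `CosetCat.pushPullAdj : push ⊣ pull` (the printed left-adjointness) via the dictionary
"morphisms `G/U → G/V` = `U`-fixed points of `G/V`" (`homMk`, `pt`, `hom_ext`), and `CosetCat G` connected and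
totally epimorphic ([FrdII] Ex. 1.1 (ii) hypotheses on a base). The comparison with `ConnectedPart (BTemp G)` (an
equivalence for profinite `G`, `QuasiTemperoid.ConnectedPartEquivOfProfinite`) is left to a bridge file. Pure
topological-group / category theory over Mathlib; nothing of the disputed series is asserted.
-/

namespace Literature.AnabelianGeometry.SemiGraphs

open CategoryTheory

universe u

/-- An object of the small coset category of a topological group `G`: an open subgroup `U ⊆ G`, standing for the
transitive `G`-set "`G/U` equipped with its natural `G`-action from the left". [cite: MochizukiFrdII2008, Ex 1.3 (i) p.11] -/
@[ext] structure CosetCat (G : Type u) [Group G] [TopologicalSpace G] : Type u where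
  /-- the open subgroup `U` (the object is `G/U`) -/
  sg : OpenSubgroup G

namespace CosetCat

variable {G : Type u} [Group G] [TopologicalSpace G]

/-- The `G`-set `G/U` underlying the object `U`. [cite: MochizukiFrdII2008, Ex 1.3 (i) p.11] -/
abbrev carrier (X : CosetCat G) : Type u := G ⧸ X.sg.toSubgroup

/-- A morphism `G/U → G/V` of the coset category: a `G`-equivariant map ("morphisms of `Π`-sets", [SemiAnbd] §3
p. 33 as recalled in [FrdII] Ex. 1.3). [cite: MochizukiFrdII2008, Ex 1.3 (i) p.11] -/
@[ext] structure Hom (X Y : CosetCat G) : Type u where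
  /-- the underlying map of coset spaces -/
  toFun : X.carrier → Y.carrier
  /-- `G`-equivariance -/
  map_smul : ∀ (g : G) (x : X.carrier), toFun (g • x) = g • toFun x

/-- The coset category: composition of equivariant maps. [cite: MochizukiFrdII2008, Ex 1.3 (i) p.11] -/
instance instCategory : Category.{u} (CosetCat G) where
  Hom := Hom
  id X := ⟨id, fun _ _ => rfl⟩
  comp f g := ⟨g.toFun ∘ f.toFun, fun a x => by rw [Function.comp_apply, f.map_smul, g.map_smul]; rfl⟩

/-- Extensionality through underlying maps. [cite: MochizukiFrdII2008, Ex 1.3 (i) p.11] -/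
theorem hom_ext_toFun {X Y : CosetCat G} {f f' : X ⟶ Y} (h : ∀ x, Hom.toFun f x = Hom.toFun f' x) : f = f' :=
  Hom.ext (funext h)

/-! ### Morphisms `G/U → G/V` = `U`-fixed points of `G/V` -/

/-- The point of `G/V` that `G/U → G/V` assigns to the coset `1·U`. [cite: MochizukiFrdII2008, Ex 1.3 (i) p.11] -/
def pt {X Y : CosetCat G} (f : X ⟶ Y) : Y.carrier := Hom.toFun f ((1 : G) : X.carrier)

/-- A morphism is `g·U ↦ g·pt`. [cite: MochizukiFrdII2008, Ex 1.3 (i) p.11] -/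
theorem toFun_coe {X Y : CosetCat G} (f : X ⟶ Y) (g : G) : Hom.toFun f (g : X.carrier) = g • pt f := by
  rw [pt, ← Hom.map_smul, MulAction.Quotient.smul_coe, smul_eq_mul, mul_one]

/-- Two morphisms `G/U → G/V` with the same point agree. [cite: MochizukiFrdII2008, Ex 1.3 (i) p.11] -/
theorem hom_ext {X Y : CosetCat G} {f f' : X ⟶ Y} (h : pt f = pt f') : f = f' :=
  hom_ext_toFun fun x => QuotientGroup.induction_on x fun g => by rw [toFun_coe, toFun_coe, h]

/-- The point of a morphism `G/U → G/V` is fixed by `U`. [cite: MochizukiFrdII2008, Ex 1.3 (i) p.11] -/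
theorem smul_pt {X Y : CosetCat G} (f : X ⟶ Y) {u : G} (hu : u ∈ X.sg) : u • pt f = pt f := by
  rw [← toFun_coe, pt]
  congr 1
  rw [QuotientGroup.eq, mul_one, inv_mem_iff]
  exact hu

/-- The morphism `G/U → G/V`, `g·U ↦ g·c`, of a `U`-fixed point `c ∈ G/V`. [cite: MochizukiFrdII2008, Ex 1.3 (i) p.11] -/
def homMk {X Y : CosetCat G} (c : Y.carrier) (hc : ∀ u ∈ X.sg, u • c = c) : X ⟶ Y where
  toFun x := Quotient.liftOn' x (fun g => g • c) fun a b hab => by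
    have hab' : a⁻¹ * b ∈ X.sg := QuotientGroup.leftRel_apply.mp hab
    calc a • c = a • ((a⁻¹ * b) • c) := by rw [hc _ hab']
      _ = b • c := by rw [← mul_smul, mul_inv_cancel_left]
  map_smul g x := QuotientGroup.induction_on x fun a => by
    rw [MulAction.Quotient.smul_coe, smul_eq_mul]
    exact mul_smul g a c

/-- `homMk c` sends `g·U` to `g·c`. [cite: MochizukiFrdII2008, Ex 1.3 (i) p.11] -/
@[simp] theorem homMk_toFun_coe {X Y : CosetCat G} (c : Y.carrier) (hc : ∀ u ∈ X.sg, u • c = c) (g : G) :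
    Hom.toFun (homMk c hc) (g : X.carrier) = g • c := rfl

/-- The point of `homMk c` is `c`. [cite: MochizukiFrdII2008, Ex 1.3 (i) p.11] -/
@[simp] theorem pt_homMk {X Y : CosetCat G} (c : Y.carrier) (hc : ∀ u ∈ X.sg, u • c = c) : pt (homMk c hc) = c := by
  rw [pt, homMk_toFun_coe, one_smul]

/-- The point of a composite: if `pt f = a·V` then `pt (f ≫ g) = a · pt g`. [cite: MochizukiFrdII2008, Ex 1.3 (i) p.11] -/
theorem pt_comp {X Y Z : CosetCat G} (f : X ⟶ Y) (g : Y ⟶ Z) : pt (f ≫ g) = Hom.toFun g (pt f) := rfl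

/-- The point of the identity of `G/U` is `1·U`. [cite: MochizukiFrdII2008, Ex 1.3 (i) p.11] -/
@[simp] theorem pt_id (X : CosetCat G) : pt (𝟙 X) = ((1 : G) : X.carrier) := rfl

/-! ### Connected and totally epimorphic ([FrdII] Ex. 1.1 (ii) hypotheses on a base category) -/

/-- The one-point object `G/G`. [cite: MochizukiFrdII2008, Ex 1.3 (i) p.11] -/
def top : CosetCat G := ⟨⊤⟩

/-- The unique morphism `G/U → G/G`. [cite: MochizukiFrdII2008, Ex 1.3 (i) p.11] -/
def toTop (X : CosetCat G) : X ⟶ top := homMk ((1 : G) : (top : CosetCat G).carrier) fun u _ => by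
  rw [MulAction.Quotient.smul_coe, QuotientGroup.eq]
  trivial

/-- The coset category is connected (every object maps to `G/G`). [cite: MochizukiFrdII2008, Ex 1.3 (i) p.11] -/
theorem isConnected : IsConnected (CosetCat G) := by
  haveI : Nonempty (CosetCat G) := ⟨top⟩
  exact zigzag_isConnected fun X Y => Zigzag.of_hom_inv (toTop X) (toTop Y)

/-- The coset category is totally epimorphic ("`E⁰` is … totally epimorphic"). [cite: MochizukiFrdII2008, Ex 1.3 (i) p.11] -/
theorem isTotallyEpimorphic : Literature.AlgebraicGeometry.Frobenioids.IsTotallyEpimorphic (CosetCat G) := by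
  refine ⟨fun {X Y} f => ⟨fun {Z} g h w => ?_⟩⟩
  obtain ⟨a, ha⟩ := Quotient.exists_rep (pt f)
  have hw : Hom.toFun g (pt f) = Hom.toFun h (pt f) := by rw [← pt_comp, ← pt_comp, w]
  have ha' : pt f = ((a : G) : Y.carrier) := ha.symm
  rw [ha', toFun_coe, toFun_coe] at hw
  exact hom_ext (smul_left_cancel a hw)

/-! ### Pull-back along a continuous surjection `aug : P → G` ("`D⊢_v ⊆ D_v`") -/

section PullPush

variable {P : Type u} [Group P] [TopologicalSpace P] (aug : P →* G) (hc : Continuous aug)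
  (hs : Function.Surjective aug)

/-- The comparison `P/aug⁻¹(V) → G/V`, `π ↦ aug π`. [cite: MochizukiFrdII2008, Ex 1.3 (ii) p.11] -/
def quotAug (V : OpenSubgroup G) : P ⧸ (V.comap aug hc).toSubgroup → G ⧸ V.toSubgroup :=
  Quotient.map' aug fun a b hab => by
    refine QuotientGroup.leftRel_apply.mpr ?_
    have hab' : a⁻¹ * b ∈ V.comap aug hc := QuotientGroup.leftRel_apply.mp hab
    have h2 : aug (a⁻¹ * b) ∈ V := OpenSubgroup.mem_comap.mp hab'
    rw [map_mul, map_inv] at h2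
    exact h2

/-- `quotAug` on a coset. [cite: MochizukiFrdII2008, Ex 1.3 (ii) p.11] -/
@[simp] theorem quotAug_coe (V : OpenSubgroup G) (π : P) :
    quotAug aug hc V (π : P ⧸ (V.comap aug hc).toSubgroup) = (aug π : G ⧸ V.toSubgroup) := rfl

/-- `quotAug` is `P`-equivariant (with `P` acting on `G/V` through `aug`). [cite: MochizukiFrdII2008, Ex 1.3 (ii) p.11] -/
theorem quotAug_smul (V : OpenSubgroup G) (π : P) (x : P ⧸ (V.comap aug hc).toSubgroup) :
    quotAug aug hc V (π • x) = aug π • quotAug aug hc V x :=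
  QuotientGroup.induction_on x fun a => by
    rw [MulAction.Quotient.smul_coe, quotAug_coe, quotAug_coe, MulAction.Quotient.smul_coe, smul_eq_mul,
      smul_eq_mul, map_mul]

include hs in
/-- `quotAug` is bijective. [cite: MochizukiFrdII2008, Ex 1.3 (ii) p.11] -/
theorem quotAug_bijective (V : OpenSubgroup G) : Function.Bijective (quotAug aug hc V) := by
  constructor
  · intro x y
    refine QuotientGroup.induction_on x fun a => QuotientGroup.induction_on y fun b => fun h => ?_
    rw [quotAug_coe, quotAug_coe, QuotientGroup.eq] at h
    refine QuotientGroup.eq.mpr ?_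
    have h2 : aug (a⁻¹ * b) ∈ V := by rw [map_mul, map_inv]; exact h
    exact OpenSubgroup.mem_comap.mpr h2
  · intro y
    refine QuotientGroup.induction_on y fun g => ?_
    obtain ⟨π, rfl⟩ := hs g
    exact ⟨(π : P ⧸ (V.comap aug hc).toSubgroup), rfl⟩

/-- `P/aug⁻¹(V) ≃ G/V`. [cite: MochizukiFrdII2008, Ex 1.3 (ii) p.11] -/
noncomputable def quotAugEquiv (V : OpenSubgroup G) : P ⧸ (V.comap aug hc).toSubgroup ≃ G ⧸ V.toSubgroup :=
  Equiv.ofBijective _ (quotAug_bijective aug hc hs V)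

/-- The comparison is `P`-equivariant. [cite: MochizukiFrdII2008, Ex 1.3 (ii) p.11] -/
theorem quotAugEquiv_smul (V : OpenSubgroup G) (π : P) (x) :
    quotAugEquiv aug hc hs V (π • x) = aug π • quotAugEquiv aug hc hs V x :=
  quotAug_smul aug hc V π x

/-- The inverse comparison is `P`-equivariant. [cite: MochizukiFrdII2008, Ex 1.3 (ii) p.11] -/
theorem quotAugEquiv_symm_smul (V : OpenSubgroup G) (π : P) (y : G ⧸ V.toSubgroup) :
    (quotAugEquiv aug hc hs V).symm (aug π • y) = π • (quotAugEquiv aug hc hs V).symm y := by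
  apply (quotAugEquiv aug hc hs V).injective
  rw [Equiv.apply_symm_apply, quotAugEquiv_smul, Equiv.apply_symm_apply]

/-- **The pull-back functor** `CosetCat G ⥤ CosetCat P`, `G/V ↦ P/aug⁻¹(V)` — `G/V` regarded as a `P`-set through
`aug` ([FrdII] Ex. 1.3 (ii) "the natural pull-back functor"; [IUTchI] Ex. 3.3 (i) `D⊢_v ⊆ D_v` "by pulling back … via
the structure morphism"). [cite: MochizukiFrdII2008, Ex 1.3 (ii) p.11] -/
noncomputable def pull : CosetCat G ⥤ CosetCat P where
  obj X := ⟨X.sg.comap aug hc⟩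
  map {X Y} f :=
    { toFun := fun x => (quotAugEquiv aug hc hs Y.sg).symm (Hom.toFun f (quotAugEquiv aug hc hs X.sg x))
      map_smul := fun π x => by
        rw [quotAugEquiv_smul, Hom.map_smul, quotAugEquiv_symm_smul] }
  map_id X := hom_ext_toFun fun x => by
    change (quotAugEquiv aug hc hs X.sg).symm (quotAugEquiv aug hc hs X.sg x) = x
    rw [Equiv.symm_apply_apply]
  map_comp {X Y Z} f g := hom_ext_toFun fun x => by
    change (quotAugEquiv aug hc hs Z.sg).symm (Hom.toFun g (Hom.toFun f (quotAugEquiv aug hc hs X.sg x))) =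
      (quotAugEquiv aug hc hs Z.sg).symm (Hom.toFun g (quotAugEquiv aug hc hs Y.sg
        ((quotAugEquiv aug hc hs Y.sg).symm (Hom.toFun f (quotAugEquiv aug hc hs X.sg x)))))
    rw [Equiv.apply_symm_apply]

/-- `P/aug⁻¹V ≃ G/V` in the typing of the pull-back functor. [cite: MochizukiFrdII2008, Ex 1.3 (ii) p.11] -/
noncomputable def pullEquiv (X : CosetCat G) : ((pull aug hc hs).obj X).carrier ≃ X.carrier :=
  quotAugEquiv aug hc hs X.sg

/-- `pullEquiv` on a coset: `π ↦ aug π`. [cite: MochizukiFrdII2008, Ex 1.3 (ii) p.11] -/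
@[simp] theorem pullEquiv_coe (X : CosetCat G) (π : P) :
    pullEquiv aug hc hs X (π : ((pull aug hc hs).obj X).carrier) = (aug π : X.carrier) := rfl

/-- `pullEquiv` is `P`-equivariant. [cite: MochizukiFrdII2008, Ex 1.3 (ii) p.11] -/
theorem pullEquiv_smul (X : CosetCat G) (π : P) (x : ((pull aug hc hs).obj X).carrier) :
    pullEquiv aug hc hs X (π • x) = aug π • pullEquiv aug hc hs X x :=
  quotAug_smul aug hc X.sg π x

/-- The inverse of `pullEquiv` is `P`-equivariant. [cite: MochizukiFrdII2008, Ex 1.3 (ii) p.11] -/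
theorem pullEquiv_symm_smul (X : CosetCat G) (π : P) (y : X.carrier) :
    (pullEquiv aug hc hs X).symm (aug π • y) = π • (pullEquiv aug hc hs X).symm y :=
  quotAugEquiv_symm_smul aug hc hs X.sg π y

/-- `pull.map f` is `f` conjugated by `pullEquiv`. [cite: MochizukiFrdII2008, Ex 1.3 (ii) p.11] -/
theorem pull_map_toFun {X Y : CosetCat G} (f : X ⟶ Y) (x : ((pull aug hc hs).obj X).carrier) :
    Hom.toFun ((pull aug hc hs).map f) x = (pullEquiv aug hc hs Y).symm (Hom.toFun f (pullEquiv aug hc hs X x)) :=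
  rfl

/-- The point of `pull.map f`. [cite: MochizukiFrdII2008, Ex 1.3 (ii) p.11] -/
theorem pt_pull_map {X Y : CosetCat G} (f : X ⟶ Y) :
    pt ((pull aug hc hs).map f) = (pullEquiv aug hc hs Y).symm (pt f) := by
  change (pullEquiv aug hc hs Y).symm (Hom.toFun f (pullEquiv aug hc hs X ((1 : P) : _))) = _
  rw [pullEquiv_coe, map_one]
  rfl

/-- The `G`-map `G/U → G/V` underlying a `P`-map `P/aug⁻¹U → P/aug⁻¹V`. [cite: Mochizuki2012, I Ex 3.3 (i) pp.77-78] -/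
noncomputable def pullPreimage {X Y : CosetCat G} (h : (pull aug hc hs).obj X ⟶ (pull aug hc hs).obj Y) : X ⟶ Y :=
  homMk (pullEquiv aug hc hs Y (pt h)) fun u hu => by
    obtain ⟨π, rfl⟩ := hs u
    have hπ : π ∈ ((pull aug hc hs).obj X).sg := hu
    rw [← pullEquiv_smul, smul_pt h hπ]

/-- The point of `pullPreimage h`. [cite: Mochizuki2012, I Ex 3.3 (i) pp.77-78] -/
@[simp] theorem pt_pullPreimage {X Y : CosetCat G} (h : (pull aug hc hs).obj X ⟶ (pull aug hc hs).obj Y) :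
    pt (pullPreimage aug hc hs h) = pullEquiv aug hc hs Y (pt h) :=
  pt_homMk _ _

/-- **`D⊢_v ⊆ D_v` is a FULL subcategory**: every `P`-map `P/aug⁻¹U → P/aug⁻¹V` comes from a `G`-map `G/U → G/V`
(`aug` surjective). [cite: Mochizuki2012, I Ex 3.3 (i) pp.77-78] -/
theorem pull_full : (pull aug hc hs).Full where
  map_surjective {X Y} h := ⟨pullPreimage aug hc hs h, hom_ext (by
    rw [pt_pull_map, pt_pullPreimage, Equiv.symm_apply_apply])⟩

/-- … and FAITHFUL. [cite: Mochizuki2012, I Ex 3.3 (i) pp.77-78] -/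
theorem pull_faithful : (pull aug hc hs).Faithful where
  map_injective {X Y} f f' h := hom_ext (by
    have := congrArg pt h
    rw [pt_pull_map, pt_pull_map] at this
    exact (pullEquiv aug hc hs Y).symm.injective this)

/-! ### Push-forward along an OPEN surjection ("`D_v → D⊢_v`", the functor `φ_*`) -/

variable (ho : IsOpenMap aug)

/-- The image `aug(U)` of an open subgroup under an open homomorphism. [cite: MochizukiFrdII2008, Ex 1.3 (ii) p.11] -/
def mapOpen (U : OpenSubgroup P) : OpenSubgroup G where
  toSubgroup := U.toSubgroup.map aug
  isOpen' := by
    change IsOpen (aug '' (U : Set P))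
    exact ho _ U.isOpen

/-- Membership in `aug(U)`. [cite: MochizukiFrdII2008, Ex 1.3 (ii) p.11] -/
theorem mem_mapOpen {U : OpenSubgroup P} {g : G} : g ∈ mapOpen aug ho U ↔ ∃ π ∈ U, aug π = g :=
  Subgroup.mem_map

/-- `P/U → G/aug(U)`, `π ↦ aug π`. [cite: MochizukiFrdII2008, Ex 1.3 (ii) p.11] -/
def quotMap (U : OpenSubgroup P) : P ⧸ U.toSubgroup → G ⧸ (mapOpen aug ho U).toSubgroup :=
  Quotient.map' aug fun a b hab => by
    refine QuotientGroup.leftRel_apply.mpr ?_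
    have hab' : a⁻¹ * b ∈ U.toSubgroup := QuotientGroup.leftRel_apply.mp hab
    change (aug a)⁻¹ * aug b ∈ U.toSubgroup.map aug
    rw [← map_inv, ← map_mul]
    exact Subgroup.mem_map_of_mem aug hab'

/-- `quotMap` on a coset. [cite: MochizukiFrdII2008, Ex 1.3 (ii) p.11] -/
@[simp] theorem quotMap_coe (U : OpenSubgroup P) (π : P) :
    quotMap aug ho U (π : P ⧸ U.toSubgroup) = (aug π : G ⧸ (mapOpen aug ho U).toSubgroup) := rfl

/-- `quotMap` is `P`-equivariant through `aug`. [cite: MochizukiFrdII2008, Ex 1.3 (ii) p.11] -/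
theorem quotMap_smul (U : OpenSubgroup P) (π : P) (x : P ⧸ U.toSubgroup) :
    quotMap aug ho U (π • x) = aug π • quotMap aug ho U x :=
  QuotientGroup.induction_on x fun a => by
    rw [MulAction.Quotient.smul_coe, quotMap_coe, quotMap_coe, MulAction.Quotient.smul_coe, smul_eq_mul,
      smul_eq_mul, map_mul]

/-- The image of the point of `h : P/U → P/U'` is `aug(U)`-fixed. [cite: MochizukiFrdII2008, Ex 1.3 (ii) p.11] -/
theorem quotMap_pt_fixed {X Y : CosetCat P} (h : X ⟶ Y) :
    ∀ g ∈ (⟨mapOpen aug ho X.sg⟩ : CosetCat G).sg, g • quotMap aug ho Y.sg (pt h) = quotMap aug ho Y.sg (pt h) := by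
  intro g hg
  obtain ⟨π, hπ, rfl⟩ := (mem_mapOpen aug ho).mp hg
  rw [← quotMap_smul, smul_pt h hπ]

/-- **The push-forward functor** `φ_* : CosetCat P ⥤ CosetCat G`, `P/U ↦ G/aug(U)` (= `Ker(aug)\(P/U)` with its
`G`-action), point `π·U'` ↦ point `aug(π)·aug(U')` ([FrdII] Ex. 1.3 (ii) "`φ` induces a natural functor `φ_*`";
[IUTchI] Ex. 3.3 (i) "a natural functor `D_v → D⊢_v`"). [cite: MochizukiFrdII2008, Ex 1.3 (ii) p.11] -/
noncomputable def push : CosetCat P ⥤ CosetCat G where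
  obj X := ⟨mapOpen aug ho X.sg⟩
  map {X Y} h := homMk (quotMap aug ho Y.sg (pt h)) (quotMap_pt_fixed aug ho h)
  map_id X := hom_ext (by rw [pt_homMk, pt_id, pt_id, quotMap_coe, map_one])
  map_comp {X Y Z} h h' := hom_ext (by
    obtain ⟨a, ha⟩ := Quotient.exists_rep (pt h)
    have ha' : pt h = ((a : P) : Y.carrier) := ha.symm
    rw [pt_homMk, pt_comp, pt_comp, pt_homMk, ha', toFun_coe, quotMap_smul, quotMap_coe, homMk_toFun_coe])

/-- `P/U → G/aug(U)` in the typing of `push`. [cite: MochizukiFrdII2008, Ex 1.3 (ii) p.11] -/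
def pushQuot (X : CosetCat P) : X.carrier → ((push aug ho).obj X).carrier := quotMap aug ho X.sg

/-- `pushQuot` on a coset. [cite: MochizukiFrdII2008, Ex 1.3 (ii) p.11] -/
@[simp] theorem pushQuot_coe (X : CosetCat P) (π : P) :
    pushQuot aug ho X (π : X.carrier) = (aug π : ((push aug ho).obj X).carrier) := rfl

/-- `pushQuot` is `P`-equivariant through `aug`. [cite: MochizukiFrdII2008, Ex 1.3 (ii) p.11] -/
theorem pushQuot_smul (X : CosetCat P) (π : P) (x : X.carrier) :
    pushQuot aug ho X (π • x) = aug π • pushQuot aug ho X x :=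
  quotMap_smul aug ho X.sg π x

/-- The point of `push.map h` is the image of the point of `h`. [cite: MochizukiFrdII2008, Ex 1.3 (ii) p.11] -/
@[simp] theorem pt_push_map {X Y : CosetCat P} (h : X ⟶ Y) :
    pt ((push aug ho).map h) = pushQuot aug ho Y (pt h) :=
  pt_homMk _ (quotMap_pt_fixed aug ho h)

/-! ### The adjunction `push ⊣ pull` ([FrdII] Ex. 1.3 (ii); [IUTchI] Ex. 3.3 (i)) -/

/-- `Hom(G/aug U, G/V) → Hom(P/U, P/aug⁻¹V)` (precompose, transport). [cite: MochizukiFrdII2008, Ex 1.3 (ii) p.11] -/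
noncomputable def adjHom (X : CosetCat P) (Y : CosetCat G) (f : (push aug ho).obj X ⟶ Y) :
    X ⟶ (pull aug hc hs).obj Y where
  toFun x := (pullEquiv aug hc hs Y).symm (Hom.toFun f (pushQuot aug ho X x))
  map_smul π x := by rw [pushQuot_smul, Hom.map_smul, pullEquiv_symm_smul]

/-- The underlying map of `adjHom f`. [cite: MochizukiFrdII2008, Ex 1.3 (ii) p.11] -/
theorem adjHom_toFun (X : CosetCat P) (Y : CosetCat G) (f : (push aug ho).obj X ⟶ Y) (x : X.carrier) :
    Hom.toFun (adjHom aug hc hs ho X Y f) x = (pullEquiv aug hc hs Y).symm (Hom.toFun f (pushQuot aug ho X x)) :=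
  rfl

/-- The point of `adjHom f` is `e⁻¹(pt f)`. [cite: MochizukiFrdII2008, Ex 1.3 (ii) p.11] -/
theorem pt_adjHom (X : CosetCat P) (Y : CosetCat G) (f : (push aug ho).obj X ⟶ Y) :
    pt (adjHom aug hc hs ho X Y f) = (pullEquiv aug hc hs Y).symm (pt f) := by
  change (pullEquiv aug hc hs Y).symm (Hom.toFun f (pushQuot aug ho X ((1 : P) : X.carrier))) = _
  rw [pushQuot_coe, map_one]
  rfl

/-- `Hom(P/U, P/aug⁻¹V) → Hom(G/aug U, G/V)`: point ↦ its image in `G/V`. [cite: MochizukiFrdII2008, Ex 1.3 (ii) p.11] -/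
noncomputable def adjInv (X : CosetCat P) (Y : CosetCat G) (k : X ⟶ (pull aug hc hs).obj Y) :
    (push aug ho).obj X ⟶ Y :=
  homMk (pullEquiv aug hc hs Y (pt k)) fun g hg => by
    obtain ⟨π, hπ, rfl⟩ := (mem_mapOpen aug ho).mp hg
    rw [← pullEquiv_smul, smul_pt k hπ]

/-- The point of `adjInv k` is `e(pt k)`. [cite: MochizukiFrdII2008, Ex 1.3 (ii) p.11] -/
@[simp] theorem pt_adjInv (X : CosetCat P) (Y : CosetCat G) (k : X ⟶ (pull aug hc hs).obj Y) :
    pt (adjInv aug hc hs ho X Y k) = pullEquiv aug hc hs Y (pt k) :=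
  pt_homMk _ _

/-- **[FrdII] Ex. 1.3 (ii) / [IUTchI] Ex. 3.3 (i): `φ_*` is LEFT ADJOINT to the pull-back** — `push aug ⊣ pull aug`
for a continuous open surjection `aug : P → G` ("a natural functor `D_v → D⊢_v`, which is left-adjoint to the
natural inclusion functor `D⊢_v ↪ D_v`"). CONSTRUCTED. [cite: Mochizuki2012, I Ex 3.3 (i) pp.77-78] -/
noncomputable def pushPullAdj : push aug ho ⊣ pull aug hc hs :=
  Adjunction.mkOfHomEquiv
    { homEquiv := fun X Y =>
        { toFun := adjHom aug hc hs ho X Y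
          invFun := adjInv aug hc hs ho X Y
          left_inv := fun f => hom_ext (by rw [pt_adjInv, pt_adjHom, Equiv.apply_symm_apply])
          right_inv := fun k => hom_ext (by rw [pt_adjHom, pt_adjInv, Equiv.symm_apply_apply]) }
      homEquiv_naturality_left_symm := fun {X' X Y} f k => hom_ext (by
        obtain ⟨a, ha⟩ := Quotient.exists_rep (pt f)
        have ha' : pt f = ((a : P) : X.carrier) := ha.symm
        change pt (adjInv aug hc hs ho X' Y (f ≫ k)) = pt ((push aug ho).map f ≫ adjInv aug hc hs ho X Y k)
        rw [pt_adjInv, pt_comp, pt_comp, pt_push_map, ha', toFun_coe, pullEquiv_smul, pushQuot_coe, toFun_coe,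
          pt_adjInv])
      homEquiv_naturality_right := fun {X Y Y'} f g => hom_ext_toFun fun x => by
        change Hom.toFun (adjHom aug hc hs ho X Y' (f ≫ g)) x =
          Hom.toFun ((pull aug hc hs).map g) (Hom.toFun (adjHom aug hc hs ho X Y f) x)
        rw [adjHom_toFun, adjHom_toFun, pull_map_toFun, Equiv.apply_symm_apply]
        rfl }

end PullPush

end CosetCat

end Literature.AnabelianGeometry.SemiGraphs
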